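import Literature.AnabelianGeometry.EtaleTheta.Discharge.Sec5Thm510ii
import Literature.AnabelianGeometry.EtaleTheta.Discharge.Sec5Thm57

/-!
# [EtTh] §5, Theorem 5.7 — step T3: the bi-Kummer difference cocycle of the transported root = (original ∘ θ) × (Kummer cocycle of the unit discrepancy) (pp. 317, 330–331 / PDF pp. 91, 104–105)

Mochizuki, *The étale theta function …*, Publ. RIMS **45** (2009)
[cite: MochizukiEtTh2009, Thm 5.7 p.330 (PDF p.104); Prop 4.3 (iii) p.317 (PDF p.91)].  Seat abc-iut-L2-d4 (node
`EtTh:Thm5.7`; row T3 of abc-iut-L2-t4's THM57-TOWER-PLAN.md); PROOF-ONLY over this seat's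
`Discharge/Sec5Thm510ii.lean` (`psiAut_sgpCap`, `psiAut_sgpCup`) and `Sec5Thm57.lean`.

The printed proof of Theorem 5.7 (p.330 (PDF p.104)) works with "the Kummer classes of Proposition 5.2, (iii)",
i.e. (Prop. 4.3 (iii), p.317 (PDF p.91)) the bi-Kummer difference cocycle `h ↦ s^⊓-gp_N(h) · s^⊔-gp_N(h)⁻¹` on
`H_{B_N}`, and compares it with its transport under `Ψ` (Thm. 4.4 (iii): "compatible with the Kummer classes").
At the `N`-th root this comparison is a COMPUTATION from what is landed: if `Ψ` transports `(s^⊓_N, s^⊔_N)` to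
`(e ≫ s^⊓_N ≫ D_c, e ≫ s^⊔_N ≫ D_p)` (my `exists_codTransport_of_div_eq`) and `s^trv_N` through `e` over `θ`
(abc-iut-L2-t4's `StrvTransport`, Thm. 4.4 (iv)), then (`Sec5Thm510ii.psiAut_sgpCap/psiAut_sgpCup`)
`Ψ^Aut(s^⊓-gp_N(h)) = D_c · s^⊓-gp_N(θh) · D_c⁻¹`, `Ψ^Aut(s^⊔-gp_N(h)) = D_p · s^⊔-gp_N(θh) · D_p⁻¹`, whence — with the
unit discrepancy `u := D_c⁻¹ · D_p` —
  `Ψ^Aut( s^⊓-gp_N(h) · s^⊔-gp_N(h)⁻¹ ) = D_c · [ (s^⊓-gp_N(θh) · s^⊔-gp_N(θh)⁻¹) · κ_u(θh) ] · D_c⁻¹`,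
  `κ_u(h′) := s^⊔-gp_N(h′) · u · s^⊔-gp_N(h′)⁻¹ · u⁻¹`
(`psiAut_biKummerDiff`): the transported difference cocycle is the `D_c`-conjugate of the original one (pulled back
along `θ`) MULTIPLIED BY THE KUMMER COCYCLE OF THE UNIT `u` for the `H_{B_N}`-action through `s^⊔-gp_N` (the
level-`N` "Kummer class of the constant function `u`" of the proof of Thm. 5.6, p.329).  This is the exact
statement the remaining steps consume: T4 (Thm. 5.6 + Prop. 5.2 (iii) + Cor. 2.8 (i): the left side is the class
of a `2l`-th root of unity, compatibly in `N`) and T5 (Prop. 3.2 (iii): Kummer injectivity on the compatible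
system `(u_N)_N` of `Sec5Thm57Tower.discrepancy_comp_beta_of_transports`).  Also recorded: `κ_u ≡ 1` exactly when
`u` commutes with `Im(s^⊔-gp_N)` (`kummerCocycle_eq_one_iff`) — the level-`N` blindness of
`Sec5Thm57.sgpCupSpec_comp_of_central` read on the cocycle side.
HONEST FRAMING: kernel-checked identities between typed §5 data under the named transport hypotheses; nothing of
[EtTh] is asserted unconditionally; no side taken on anything downstream. -/

namespace Literature.AnabelianGeometry.EtaleTheta

open CategoryTheory

universe w v v' u u'

namespace ThetaFrobenioid

variable {C : Type u} [Category.{v} C] {D : Type u'} [Category.{v'} D] {𝔉 : ThetaFrobenioid.{w} C D}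

/-- The identity behind T3, in any group: `a·u·b⁻¹·u⁻¹… ` — precisely
`(Dc·a·Dc⁻¹)·(Dp·b·Dp⁻¹)⁻¹ = Dc·((a·b⁻¹)·(b·u·b⁻¹·u⁻¹))·Dc⁻¹` with `u = Dc⁻¹·Dp`.
[cite: MochizukiEtTh2009, Prop 4.3 (iii) p.317 (PDF p.91)] -/
theorem conj_mul_conj_inv_eq {G : Type*} [Group G] (Dc Dp a b : G) :
    (Dc * a * Dc⁻¹) * (Dp * b * Dp⁻¹)⁻¹ =
      Dc * ((a * b⁻¹) * (b * (Dc⁻¹ * Dp) * b⁻¹ * (Dc⁻¹ * Dp)⁻¹)) * Dc⁻¹ := by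
  group

section T3

variable (Ψ : C ≌ C) (α : Ψ.functor.obj 𝔉.AN ≅ 𝔉.AN) (β : Ψ.functor.obj 𝔉.BN ≅ 𝔉.BN) (e : 𝔉.AN ≅ 𝔉.AN)
  (Dc Dp : Aut 𝔉.BN) (θ : Aut (𝔉.base.obj 𝔉.BN) ≃* Aut (𝔉.base.obj 𝔉.BN))

/-- **T3 — the transported bi-Kummer difference cocycle.**  Under the transport of the root (`hT`, `hT'`: my
`exists_codTransport_of_div_eq` / abc-iut-L2-t4's `RootTransportWith` shape) and of `s^trv_N` through `e` over `θ`
(`hstrv` = `StrvTransport`, Thm. 4.4 (iv)), with the defining relations `SgpCapSpec`/`SgpCupSpec` (p.331) and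
`θ(H_{B_N}) = H_{B_N}` (Prop. 2.4): for `h ∈ H_{B_N}`,
`Ψ^Aut(s^⊓-gp_N(h)·s^⊔-gp_N(h)⁻¹) = D_c·((s^⊓-gp_N(θh)·s^⊔-gp_N(θh)⁻¹)·(s^⊔-gp_N(θh)·u·s^⊔-gp_N(θh)⁻¹·u⁻¹))·D_c⁻¹`,
`u = D_c⁻¹·D_p` — the Kummer class of Prop. 5.2 (iii)/Prop. 4.3 (iii) is transported to itself (along `θ`, up to the
inner automorphism `D_c`) TIMES the Kummer cocycle of the unit `u` (proof of Thm. 5.6 p.329: "the Kummer class of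
the constant function `u`"; Thm. 4.4 (iii): "compatible with the Kummer classes").
[cite: MochizukiEtTh2009, Thm 5.7 p.330 (PDF p.104); Thm 4.4 (iii) p.320 (PDF p.94); Prop 4.3 (iii) p.317 (PDF p.91)] -/
theorem psiAut_biKummerDiff [Epi 𝔉.sCap] [Epi 𝔉.sCup] (hcap : 𝔉.SgpCapSpec) (hcup : 𝔉.SgpCupSpec)
    (hT : α.inv ≫ Ψ.functor.map 𝔉.sCap ≫ β.hom = e.hom ≫ 𝔉.sCap ≫ Dc.hom)
    (hT' : α.inv ≫ Ψ.functor.map 𝔉.sCup ≫ β.hom = e.hom ≫ 𝔉.sCup ≫ Dp.hom)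
    (hstrv : ∀ g : Aut (𝔉.base.obj 𝔉.BN),
      α.inv ≫ Ψ.functor.map (𝔉.strv (𝔉.autBaseIsoAB.symm g)).hom ≫ α.hom ≫ e.hom =
        e.hom ≫ (𝔉.strv (𝔉.autBaseIsoAB.symm (θ g))).hom)
    (hYdd : 𝔉.HB.map θ.toMonoidHom = 𝔉.HB) (h : 𝔉.HB) :
    𝔉.psiAut Ψ β (𝔉.sgpCap (h : Aut (𝔉.base.obj 𝔉.BN)) * (𝔉.sgpCup h)⁻¹) =
      Dc * ((𝔉.sgpCap (θ h) * (𝔉.sgpCup ⟨θ h, (mem_iff_of_map_equiv_eq hYdd _).mpr h.2⟩)⁻¹) *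
        (𝔉.sgpCup ⟨θ h, (mem_iff_of_map_equiv_eq hYdd _).mpr h.2⟩ * (Dc⁻¹ * Dp) *
          (𝔉.sgpCup ⟨θ h, (mem_iff_of_map_equiv_eq hYdd _).mpr h.2⟩)⁻¹ * (Dc⁻¹ * Dp)⁻¹)) * Dc⁻¹ := by
  rw [map_mul, map_inv, psiAut_sgpCap Ψ β α e Dc θ hcap hT hstrv, psiAut_sgpCup Ψ β α e Dp θ hcup hT' hstrv hYdd]
  exact conj_mul_conj_inv_eq Dc Dp _ _

/-- **The same with a unit discrepancy CENTRALISED by `Im(s^⊔-gp_N)`**: then the Kummer cocycle of `u` is trivial and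
the difference cocycle is transported to its `D_c`-conjugate along `θ` ON THE NOSE — the cocycle-side reading of the
level-`N` blindness `Sec5Thm57.sgpCupSpec_comp_of_central` (a central unit rescaling is invisible to the mod-`N`
Kummer class).  [cite: MochizukiEtTh2009, Thm 5.7 p.330 (PDF p.104); Rmk 4.3.2 p.319 (PDF p.93)] -/
theorem psiAut_biKummerDiff_of_central [Epi 𝔉.sCap] [Epi 𝔉.sCup] (hcap : 𝔉.SgpCapSpec) (hcup : 𝔉.SgpCupSpec)
    (hT : α.inv ≫ Ψ.functor.map 𝔉.sCap ≫ β.hom = e.hom ≫ 𝔉.sCap ≫ Dc.hom)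
    (hT' : α.inv ≫ Ψ.functor.map 𝔉.sCup ≫ β.hom = e.hom ≫ 𝔉.sCup ≫ Dp.hom)
    (hstrv : ∀ g : Aut (𝔉.base.obj 𝔉.BN),
      α.inv ≫ Ψ.functor.map (𝔉.strv (𝔉.autBaseIsoAB.symm g)).hom ≫ α.hom ≫ e.hom =
        e.hom ≫ (𝔉.strv (𝔉.autBaseIsoAB.symm (θ g))).hom)
    (hYdd : 𝔉.HB.map θ.toMonoidHom = 𝔉.HB)
    (hcentral : ∀ h' : 𝔉.HB, 𝔉.sgpCup h' * (Dc⁻¹ * Dp) = (Dc⁻¹ * Dp) * 𝔉.sgpCup h') (h : 𝔉.HB) :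
    𝔉.psiAut Ψ β (𝔉.sgpCap (h : Aut (𝔉.base.obj 𝔉.BN)) * (𝔉.sgpCup h)⁻¹) =
      Dc * (𝔉.sgpCap (θ h) * (𝔉.sgpCup ⟨θ h, (mem_iff_of_map_equiv_eq hYdd _).mpr h.2⟩)⁻¹) * Dc⁻¹ := by
  rw [psiAut_biKummerDiff Ψ α β e Dc Dp θ hcap hcup hT hT' hstrv hYdd h, hcentral, mul_inv_cancel_right,
    mul_inv_cancel, mul_one]

end T3

/-! ### The Kummer cocycle of a unit for the `H_{B_N}`-action through `s^⊔-gp_N` -/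

/-- `κ_u(h) := s^⊔-gp_N(h) · u · s^⊔-gp_N(h)⁻¹ · u⁻¹` is trivial for all `h` iff `u` commutes with every value of
`s^⊔-gp_N` — the units INVISIBLE to the mod-`N` Kummer class are exactly those centralised by `Im(s^⊔-gp_N)` (for a
unit of `B_N`: the constants fixed by `H_{B_N}`; Lemma 5.8 p.331 / Rmk 4.3.2 p.319).
[cite: MochizukiEtTh2009, Lem 5.8 p.331 (PDF p.105); Rmk 4.3.2 p.319 (PDF p.93)] -/
theorem kummerCocycle_eq_one_iff (u : Aut 𝔉.BN) :
    (∀ h : 𝔉.HB, 𝔉.sgpCup h * u * (𝔉.sgpCup h)⁻¹ * u⁻¹ = 1) ↔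
      ∀ h : 𝔉.HB, 𝔉.sgpCup h * u = u * 𝔉.sgpCup h := by
  refine forall_congr' fun h => ?_
  rw [mul_inv_eq_one, mul_inv_eq_iff_eq_mul]

end ThetaFrobenioid

end Literature.AnabelianGeometry.EtaleTheta
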